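import Summits.Schanuel.Schanuel.Theorems.RootDecomp1BTwoRadical03

/-!
# RootDecomp1BTwoRadical — lens 4, generation 44, node 2 (g44b) «TWO-RADICAL DESCENT — t(1, ρ) = 5 AT THE RATIONAL COLUMN FOR EVERY ULTRA-LIOUVILLE ρ, HYPOTHESIS-FREE» (lanes B-R29 (ii) ∩ B-R30 (iv)/(d); CLAIM L2259, NODE L2268 / REQUEST L2269; critic VERDICT pending at staging — filed only on GO) — continuation (RootDecomp1BTwoRadical04): §D2 part 2 — THE KERNEL `algebraicIndependent_twoRadical`

(lens-4 g44b HOME kernel K = HOME/decomp-schanuel-lens-4/g44b/TwoRadical.lean b925f14a…, 1327 l, imports tree `…RootDecomp1BFactDischarge01` ONLY; P/C per NODE.md. Port by census-1 gen 19 as `RootDecomp1BTwoRadical01`–`05` from the CENSUS CAP EDITION TwoRadical.capped.lean (census/tools/gen19/ports/tr/; = K with steps (2)–(5) of the kernel extracted as the public lemma `twoRadical_clash`, kernel statement BYTE-IDENTICAL, 53/53 decls identical + 1 new — same cut as TwoStorey's, RESHAPE RULE L1684): 01 = §A2 formal algebra of TWO radicals (`fiber_sum₂`, `powSubst₂`,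 `residue_lemma₂`, the q²×q² norm form `radMat₂`, `det_radMat₂_ne_zero`, `det_eq_eigen_mul₂`); 02 = §C2 the specialisation (`Cf₂`, `Frel₂`, sizes, Lipschitz, `eigen_eq_Frel₂` — TwoRadical's own versions, namespace-distinct from TwoStorey's); 03 = §D2 part 1: the private helper + the CLASH ENGINE `twoRadical_clash`; 04 = §D2 part 2: THE KERNEL `algebraicIndependent_twoRadical` (scoped `maxHeartbeats 1600000` as in K); 05 = §E2 cells mod `(hLW : LWMeasure)` + §F2 hypothesis-free via `lwMeasure_holds` (`five_le_polarDeg_one_ultra : ((5 : ℕ) : Cardinal) ≤ polarDeg ![(1:ℝ), ρ]` for EVERY ultra-Liouville ρ, `five_le_polarDeg_one_rhoU`, …) + §G2 the coordinate column at every storey (`polarDeg_snoc_ultra₂`, …).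
PORT EDITS: linter option dropped; one docstring added (`powSubst₂_apply`); §D2 re-cut for the 400-line cap (one new public lemma `twoRadical_clash`; eigenvector coordinates abstracted as `w` with `‖w c‖ ≤ Θ^q·Θ^q`, eigenvalue as `Φ`; thirteen now-unused local `have`s of the kernel dropped); every other statement and proof verbatim. `--supports stmt-Schanuel-24622`; no census credit carried; rung 0 — nothing here proves Schanuel.)
-/

noncomputable section

open Complex

namespace Summit.Schanuel.Schanuel.Theorems.RootDecomp1BTwoRadical

section Kernel

open MvPolynomial
open Summit.Schanuel.Schanuel.Theorems.RootDecomp1KHyper (mvlen mvlen_nonneg one_le_mvlen exists_ball_eval_ne_zero)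
open RootDecomp1BRadicalDescent (resFin DExpMeasure UltraLiouville exists_int_relation norm_mvaeval_le_mvlen
  totalDegree_det_le mvlen_det_le adjugate_bounds kernel_clash_ineq)

variable {n : ℕ}

set_option maxHeartbeats 1600000 in
/-- **KERNEL THEOREM (two-radical descent).** Let `θ ∈ ℂⁿ` carry a degree-uniform transcendence measure
(`DExpMeasure θ`), let `e^{y₀} = θ_{i₀}`, `e^{y₁} = θ_{i₁}` with `i₀ ≠ i₁`, and let `ρ > 0` be ultra-Liouville. Then
`(e^{ρ y₀}, e^{ρ y₁}, ρ, θ_1, …, θ_n)` is algebraically independent over `ℚ`.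

Proof: an integer relation `P(e^{ρy₀}, e^{ρy₁}, ρ, θ) = 0` is specialised at `ρ ≈ p/q`; with `s = e^{y₀/q}`, `s' = e^{y₁/q}`
(`s^q = θ_{i₀}`, `s'^q = θ_{i₁}`, `s^p = e^{(p/q) y₀}`, `s'^p = e^{(p/q) y₁}`) the specialisation
`Φ(s, s') = q^J P(s^p, s'^p, p/q, θ)` is tiny (Lipschitz), it is an eigenvalue of the `q² × q²` norm-form matrix `M(θ)` of
`Σ_{k,k'} C_{kk'} T^{pk} S^{pk'}` modulo `(T^q − θ_{i₀}, S^q − θ_{i₁})`, whose determinant `N(θ)`, `N = det M ∈ ℤ[X] ∖ 0`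
(formal non-vanishing, §A2), is bounded BELOW by the measure at the FIXED point `θ` and ABOVE by `|Φ| · ‖adj M(θ)‖` — a
contradiction for `q` large (g30's clash inequality at `q² ` in place of `q`).
(Census cap edition of the port, statement byte-identical: steps (2)–(5) of the g44 proof are the lemma
`twoRadical_clash` above, applied at the end; steps (0)–(1) verbatim.) -/
theorem algebraicIndependent_twoRadical {θ : Fin n → ℂ} (hθ : DExpMeasure θ) {i₀ i₁ : Fin n} (hne : i₀ ≠ i₁)
    {y₀ y₁ : ℂ} (hy₀ : cexp y₀ = θ i₀) (hy₁ : cexp y₁ = θ i₁) {ρ : ℝ} (hρ : UltraLiouville ρ) (hρ0 : 0 < ρ) :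
    AlgebraicIndependent ℚ
      (Fin.cons (cexp ((ρ : ℂ) * y₀)) (Fin.cons (cexp ((ρ : ℂ) * y₁)) (Fin.cons (ρ : ℂ) θ)) : Fin (n + 3) → ℂ) := by
  classical
  by_contra hdep
  obtain ⟨P, hP0, hPv⟩ := exists_int_relation hdep
  obtain ⟨A₀, hA₀⟩ := hθ
  -- degrees and the partial degrees in `U, V` (coordinates 0, 1) and `Y` (coordinate 2)
  set dP := P.totalDegree with hdP
  set K := max (P.degreeOf 0) (P.degreeOf 1) with hKdef
  set J := P.degreeOf 2 with hJdef
  have hK : ∀ s ∈ P.support, s 0 ≤ K ∧ s 1 ≤ K := fun s hs =>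
    ⟨(monomial_le_degreeOf 0 hs).trans (le_max_left _ _), (monomial_le_degreeOf 1 hs).trans (le_max_right _ _)⟩
  have hJ : ∀ s ∈ P.support, s 2 ≤ J := fun s hs => monomial_le_degreeOf 2 hs
  -- the C¹ function F, its root ρ and a local Lipschitz constant
  have hFρ : Frel₂ P θ y₀ y₁ ρ = 0 := by rw [Frel₂_eq_aeval]; exact hPv
  obtain ⟨Kl, δ₁, hKl, hδ₁, hLip⟩ := exists_lipschitz_Frel₂ P θ y₀ y₁ ρ
  -- the fibre polynomial μ of a monomial s₀ of P (guarantees some `C_{kk'} ≠ 0` after specialisation)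
  obtain ⟨s₀, hs₀⟩ : ∃ s₀, s₀ ∈ P.support := by
    obtain ⟨t, ht⟩ := MvPolynomial.ne_zero_iff.mp hP0
    exact ⟨t, mem_support_iff.mpr ht⟩
  set kk₀ : ℕ × ℕ := (s₀ 0, s₀ 1) with hkk₀
  set m₀ : Fin n →₀ ℕ := sX₃ s₀ with hm₀
  obtain ⟨μ, hμ⟩ : ∃ μ : Polynomial ℂ, μ = ∑ s ∈ P.support with ((s 0, s 1) = kk₀ ∧ sX₃ s = m₀),
    Polynomial.C ((P.coeff s : ℤ) : ℂ) * Polynomial.X ^ (s 2) := ⟨_, rfl⟩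
  have hμ0 : μ ≠ 0 := by
    intro h
    have hc : μ.coeff (s₀ 2) = ((P.coeff s₀ : ℤ) : ℂ) := by
      rw [hμ, Polynomial.finsetSum_coeff]
      simp only [Polynomial.coeff_C_mul, Polynomial.coeff_X_pow]
      rw [Finset.sum_eq_single s₀]
      · simp
      · intro s hs hne'
        have hs' := (Finset.mem_filter.1 hs).2
        rw [if_neg, mul_zero]
        intro h1
        exact hne' (eq_of_parts₃ (congrArg Prod.fst hs'.1) (congrArg Prod.snd hs'.1) h1.symm hs'.2)
      · intro h'
        exact absurd (Finset.mem_filter.2 ⟨hs₀, rfl, rfl⟩) h'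
    rw [h, Polynomial.coeff_zero] at hc
    exact (Int.cast_ne_zero.2 (mem_support_iff.1 hs₀)) hc.symm
  obtain ⟨δ₀, hδ₀, hμball⟩ := exists_ball_eval_ne_zero μ hμ0 ρ
  have hμeval : ∀ x : ℂ, μ.eval x = ∑ s ∈ P.support with ((s 0, s 1) = kk₀ ∧ sX₃ s = m₀),
      ((P.coeff s : ℤ) : ℂ) * x ^ (s 2) := by
    intro x
    simp only [hμ, Polynomial.eval_finsetSum, Polynomial.eval_mul, Polynomial.eval_C,
      Polynomial.eval_pow, Polynomial.eval_X]
  -- q-independent sizes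
  set Θ : ℝ := 1 + ∑ i, ‖θ i‖ with hΘ
  have hsum0 : 0 ≤ ∑ i, ‖θ i‖ := Finset.sum_nonneg fun i _ => norm_nonneg (θ i)
  have hΘ1 : 1 ≤ Θ := by rw [hΘ]; linarith
  have hθΘ : ∀ i, ‖θ i‖ ≤ Θ := fun i => by
    have := Finset.single_le_sum (fun j (_ : j ∈ Finset.univ) => norm_nonneg (θ j)) (Finset.mem_univ i)
    rw [hΘ]; linarith
  set Bρ : ℕ := ⌈ρ⌉₊ + 1 with hBρ
  have hBρ1 : ρ + 1 ≤ Bρ := by rw [hBρ]; push_cast; linarith [Nat.le_ceil ρ]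
  set δe : ℕ := dP + 2 * (Bρ * K) with hδe
  set LP : ℤ := mvlen P with hLP
  have hLP1 : 1 ≤ LP := one_le_mvlen hP0
  set A : ℕ := A₀ + 1 with hA
  set a : ℝ := A * ((δe : ℝ) + 1) ^ A with ha
  set cE : ℝ := 2 * ((K : ℝ) + 1) + LP + J * ((Bρ : ℝ) + 1) with hcE
  set cN : ℝ := cE + 2 with hcN
  set cU : ℝ := ((J : ℝ) + 2) + cE + Θ * ((δe : ℝ) + 2) with hcU
  set c₃ : ℝ := (Kl + 1) + cU + cN with hc₃
  -- thresholds and the approximation r = p/q (order 2(A+1): the clash runs at q² in place of q)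
  set δs : ℝ := min (min δ₀ δ₁) (min ρ 1) with hδs
  have hδs0 : 0 < δs := lt_min (lt_min hδ₀ hδ₁) (lt_min hρ0 one_pos)
  obtain ⟨Q₁, hQ₁⟩ := exists_nat_gt (c₃ + 2 + a)
  obtain ⟨Q₂, hQ₂⟩ := exists_nat_gt (-Real.log δs)
  obtain ⟨r, hrQ, hrm, hrne, hrlt⟩ := hρ.exists_den_ge (2 * (A + 1)) (max (max Q₁ Q₂) (K + 2))
  set q : ℕ := r.den with hqdef
  have hqK2 : K + 2 ≤ q := (le_max_right _ _).trans hrQ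
  have hqQ₁ : Q₁ ≤ q := ((le_max_left _ _).trans (le_max_left _ _)).trans hrQ
  have hqQ₂ : Q₂ ≤ q := ((le_max_right _ _).trans (le_max_left _ _)).trans hrQ
  have hq : 0 < q := by omega
  have hKq : K < q := by omega
  have hq1r : (1 : ℝ) ≤ q := by exact_mod_cast hq
  have hq0r : (0 : ℝ) < q := by positivity
  have hqqN : Q₁ ≤ q * q := hqQ₁.trans (Nat.le_mul_self q)
  -- |ρ − r| < δs
  have hsmall : Real.exp (-Real.exp ((q : ℝ) ^ (2 * (A + 1)))) < δs := by
    have h1 : (q : ℝ) ≤ (q : ℝ) ^ (2 * (A + 1)) := le_self_pow₀ hq1r (by omega)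
    have h2 : (q : ℝ) ^ (2 * (A + 1)) + 1 ≤ Real.exp ((q : ℝ) ^ (2 * (A + 1))) := Real.add_one_le_exp _
    have h3 : (Q₂ : ℝ) ≤ q := by exact_mod_cast hqQ₂
    rw [← Real.exp_log hδs0, Real.exp_lt_exp]
    linarith
  have hρr : |ρ - r| < δs := hrlt.trans hsmall
  have hρr₀ : |(r : ℝ) - ρ| < δ₀ := by
    rw [abs_sub_comm]; exact hρr.trans_le ((min_le_left _ _).trans (min_le_left _ _))
  have hρr₁ : |(r : ℝ) - ρ| < δ₁ := by
    rw [abs_sub_comm]; exact hρr.trans_le ((min_le_left _ _).trans (min_le_right _ _))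
  have hρrρ : |ρ - r| < ρ := hρr.trans_le ((min_le_right _ _).trans (min_le_left _ _))
  have hρr1 : |ρ - r| < 1 := hρr.trans_le ((min_le_right _ _).trans (min_le_right _ _))
  have hr0 : (0 : ℝ) < r := by have := abs_lt.1 hρrρ; linarith
  have hr0' : (0 : ℚ) < r := by exact_mod_cast hr0
  -- p, coprimality, r = p/q
  set p : ℕ := r.num.natAbs with hpdef
  have hpnum : (p : ℤ) = r.num := Int.natAbs_of_nonneg (Rat.num_pos.2 hr0').le
  have hpq : Nat.Coprime p q := r.reduced
  have hr_eq : (r : ℝ) = (p : ℝ) / q := by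
    rw [Rat.cast_def, hqdef]
    congr 1
    rw [← hpnum]; push_cast; rfl
  have hr_eqC : ((r : ℚ) : ℂ) = (p : ℂ) / (q : ℂ) := by
    rw [← Complex.ofReal_ratCast, hr_eq]; push_cast; rfl
  have hpB : p ≤ Bρ * q := by
    have h1 : (r : ℝ) < ρ + 1 := by have := abs_lt.1 hρr1; linarith
    have h2 : (p : ℝ) / q < Bρ := by rw [← hr_eq]; linarith
    have h3 : (p : ℝ) < Bρ * q := by rwa [div_lt_iff₀ hq0r] at h2
    exact_mod_cast h3.le
  -- the radicals s = e^{y₀/q}, s' = e^{y₁/q}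
  obtain ⟨s, hsdef⟩ : ∃ s : ℂ, s = cexp (y₀ / q) := ⟨_, rfl⟩
  obtain ⟨s', hs'def⟩ : ∃ s' : ℂ, s' = cexp (y₁ / q) := ⟨_, rfl⟩
  have hqC : (q : ℂ) ≠ 0 := by exact_mod_cast hq.ne'
  have hsq : s ^ q = θ i₀ := by
    rw [hsdef, ← Complex.exp_nat_mul, mul_div_cancel₀ _ hqC, hy₀]
  have hs'q : s' ^ q = θ i₁ := by
    rw [hs'def, ← Complex.exp_nat_mul, mul_div_cancel₀ _ hqC, hy₁]
  have hsp : s ^ p = cexp (((((p : ℝ) / q : ℝ)) : ℂ) * y₀) := by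
    rw [hsdef, ← Complex.exp_nat_mul]
    congr 1
    push_cast
    field_simp
  have hs'p : s' ^ p = cexp (((((p : ℝ) / q : ℝ)) : ℂ) * y₁) := by
    rw [hs'def, ← Complex.exp_nat_mul]
    congr 1
    push_cast
    field_simp
  have hrootΘ : ∀ {z : ℂ} {i : Fin n}, z ^ q = θ i → ‖z‖ ≤ Θ := by
    intro z i hz
    by_contra h
    push Not at h
    have h1 : 1 ≤ ‖z‖ := hΘ1.trans h.le
    have h2 : ‖z‖ ≤ ‖z‖ ^ q := le_self_pow₀ h1 (by omega)
    have h3 : ‖z‖ ^ q = ‖θ i‖ := by rw [← norm_pow, hz]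
    linarith [hθΘ i]
  have hsΘ : ‖s‖ ≤ Θ := hrootΘ hsq
  have hs'Θ : ‖s'‖ ≤ Θ := hrootΘ hs'q
  -- some C_{kk'} is nonzero: C_{kk₀} has the coefficient q^J μ(r) ≠ 0 at m₀
  have hC : ∃ kk ∈ Finset.range (K + 1) ×ˢ Finset.range (K + 1), Cf₂ P p q J kk ≠ 0 := by
    refine ⟨kk₀, Finset.mem_product.2 ⟨Finset.mem_range.2 (Nat.lt_succ_of_le (hK s₀ hs₀).1),
      Finset.mem_range.2 (Nat.lt_succ_of_le (hK s₀ hs₀).2)⟩, fun h0 => ?_⟩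
    have hcoef : (Cf₂ P p q J kk₀).coeff m₀ =
        ∑ s ∈ P.support with ((s 0, s 1) = kk₀ ∧ sX₃ s = m₀),
          P.coeff s * (p : ℤ) ^ (s 2) * (q : ℤ) ^ (J - s 2) := by
      rw [Cf₂, coeff_sum]
      simp only [coeff_monomial]
      rw [Finset.sum_filter, Finset.sum_filter]
      refine Finset.sum_congr rfl fun s _ => ?_
      by_cases h1 : (s 0, s 1) = kk₀ <;> by_cases h2 : sX₃ s = m₀ <;> simp [h1, h2]
    have hcast : (((Cf₂ P p q J kk₀).coeff m₀ : ℤ) : ℂ) = (q : ℂ) ^ J * μ.eval ((r : ℝ) : ℂ) := by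
      rw [hcoef, hμeval, Finset.mul_sum]
      push_cast
      refine Finset.sum_congr rfl fun s hs => ?_
      have hs1 : s 2 ≤ J := hJ s (Finset.mem_filter.1 hs).1
      rw [hr_eqC, ← pow_sub_mul_pow (q : ℂ) hs1, div_pow]
      field_simp
    have hμr : μ.eval ((r : ℝ) : ℂ) ≠ 0 := hμball r (fun h => hrne (by exact_mod_cast h.symm)) hρr₀
    have : (((Cf₂ P p q J kk₀).coeff m₀ : ℤ) : ℂ) = 0 := by rw [h0, coeff_zero, Int.cast_zero]
    rw [hcast] at this
    exact (mul_ne_zero (pow_ne_zero _ hqC) hμr) this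
  -- the norm form N = det M ≠ 0 (M = the q²×q² two-radical matrix transported to `Fin (q·q)`) and its evaluation
  obtain ⟨e⟩ : Nonempty (Fin q × Fin q ≃ Fin (q * q)) := ⟨finProdFinEquiv⟩
  obtain ⟨M, hMdef⟩ : ∃ M : Matrix (Fin (q * q)) (Fin (q * q)) (MvPolynomial (Fin n) ℤ),
      M = Matrix.reindex e e (radMat₂ (Cf₂ P p q J) K p hq i₀ i₁) := ⟨_, rfl⟩
  have hM_apply : ∀ ρ' c', M ρ' c' = radMat₂ (Cf₂ P p q J) K p hq i₀ i₁ (e.symm ρ') (e.symm c') := by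
    intro ρ' c'
    rw [hMdef, Matrix.reindex_apply, Matrix.submatrix_apply]
  obtain ⟨N, hNdef⟩ : ∃ N : MvPolynomial (Fin n) ℤ, N = M.det := ⟨_, rfl⟩
  have hN0 : N ≠ 0 := by
    rw [hNdef, hMdef, Matrix.det_reindex_self]
    exact det_radMat₂_ne_zero i₀ i₁ q hne (Cf₂ P p q J) hq hKq hpq hC
  obtain ⟨f, hfdef⟩ : ∃ f : MvPolynomial (Fin n) ℤ →+* ℂ, f = (MvPolynomial.aeval θ).toRingHom :=
    ⟨_, rfl⟩
  have hf : ∀ Q : MvPolynomial (Fin n) ℤ, f Q = aeval θ Q := fun Q => by rw [hfdef]; rfl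
  obtain ⟨Mθ, hMθ⟩ : ∃ Mθ : Matrix (Fin (q * q)) (Fin (q * q)) ℂ, Mθ = f.mapMatrix M := ⟨_, rfl⟩
  have hMθ_apply : ∀ l a', Mθ l a' = aeval θ (M l a') := fun l a' => by
    rw [hMθ, RingHom.mapMatrix_apply, Matrix.map_apply, hf]
  have hdet : Mθ.det = aeval θ N := by rw [hMθ, ← RingHom.map_det, hf, hNdef]
  set z : Fin (q * q) := e (⟨0, hq⟩, ⟨0, hq⟩) with hz
  have hadj : ∀ a' : Fin (q * q), Mθ.adjugate z a' = aeval θ (M.adjugate z a') := by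
    intro a'
    rw [hMθ, ← RingHom.map_adjugate, RingHom.mapMatrix_apply, Matrix.map_apply, hf]
  -- entry bounds
  obtain ⟨E, hEdef⟩ : ∃ E : ℤ, E = ((K : ℤ) + 1) ^ 2 * (LP * ((p : ℤ) + q) ^ J) := ⟨_, rfl⟩
  have hE1 : 1 ≤ E := by
    have h1 : (1 : ℤ) ≤ ((K : ℤ) + 1) ^ 2 := one_le_pow₀ (by linarith [Int.natCast_nonneg K])
    have h2 : (1 : ℤ) ≤ ((p : ℤ) + q) ^ J :=
      one_le_pow₀ (by linarith [Int.natCast_nonneg p, show (1:ℤ) ≤ q by exact_mod_cast hq])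
    rw [hEdef]
    calc (1 : ℤ) = 1 * (1 * 1) := by ring
      _ ≤ ((K : ℤ) + 1) ^ 2 * (LP * ((p : ℤ) + q) ^ J) :=
          mul_le_mul h1 (mul_le_mul hLP1 h2 zero_le_one (by linarith)) (by norm_num) (by positivity)
  have hentry : ∀ l a', mvlen (M l a') ≤ E := fun l a' => by
    rw [hM_apply, hEdef]
    exact mvlen_radMat₂_le P p q J hq i₀ i₁ (fun kk => mvlen_Cf₂_le P p q J hJ kk)
      (mul_nonneg (mvlen_nonneg P) (pow_nonneg (by positivity) _)) _ _
  have hentry' : ∀ l a', (M l a').totalDegree ≤ δe := fun l a' => by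
    rw [hM_apply]
    exact totalDegree_radMat₂_le P p q J hq i₀ i₁ hpB _ _
  have hNlen : mvlen N ≤ ((q * q).factorial : ℤ) * E ^ (q * q) := by rw [hNdef]; exact mvlen_det_le M hentry
  have hNdeg : N.totalDegree ≤ (q * q) * δe := by rw [hNdef]; exact totalDegree_det_le M hentry'
  have hadjB : ∀ a' : Fin (q * q), mvlen (M.adjugate z a') ≤ ((q * q).factorial : ℤ) * E ^ (q * q) ∧
      (M.adjugate z a').totalDegree ≤ (q * q) * δe := fun a' => adjugate_bounds M hE1 hentry hentry' _ _
  -- (1) the eigen factorisation  det Mθ = Φθ(s,s') · Σ_c adj z c s^a s'^{a'},  Φθ = q^J F(r)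
  have hfact := det_eq_eigen_mul₂ hq K p (fun kk => aeval θ (Cf₂ P p q J kk)) (θ i₀) (θ i₁) s s' hsq hs'q e Mθ
    (by
      intro ρ' c'
      rw [hMθ_apply, hM_apply]
      simp only [radMat₂, map_sum, map_mul, map_pow, aeval_X])
  have heigen : ∑ kk ∈ Finset.range (K + 1) ×ˢ Finset.range (K + 1),
      aeval θ (Cf₂ P p q J kk) * (s ^ (p * kk.1) * s' ^ (p * kk.2)) =
      (q : ℂ) ^ J * Frel₂ P θ y₀ y₁ ((p : ℝ) / q) :=
    eigen_eq_Frel₂ P p q J θ y₀ y₁ hK hJ hq s s' hsp hs'p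
  -- the eigenvalue is small: ‖Φ‖ ≤ q^J · Kl · |r − ρ|
  have hΦ : ‖∑ kk ∈ Finset.range (K + 1) ×ˢ Finset.range (K + 1),
      aeval θ (Cf₂ P p q J kk) * (s ^ (p * kk.1) * s' ^ (p * kk.2))‖ ≤ (q : ℝ) ^ J * (Kl * |(r : ℝ) - ρ|) := by
    rw [heigen, norm_mul, norm_pow, Complex.norm_natCast]
    refine mul_le_mul_of_nonneg_left ?_ (by positivity)
    have := hLip ((p : ℝ) / q) (by rw [← hr_eq]; exact hρr₁)
    rw [hFρ, sub_zero] at this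
    rw [hr_eq]
    exact this
  -- the eigenvector coordinates are bounded by Θ^q·Θ^q
  have hw : ∀ a' : Fin (q * q), ‖s ^ ((e.symm a').1 : ℕ) * s' ^ ((e.symm a').2 : ℕ)‖ ≤ Θ ^ q * Θ ^ q := by
    intro a'
    rw [norm_mul, norm_pow, norm_pow]
    exact mul_le_mul
      ((pow_le_pow_left₀ (norm_nonneg _) hsΘ _).trans (pow_le_pow_right₀ hΘ1 (e.symm a').1.isLt.le))
      ((pow_le_pow_left₀ (norm_nonneg _) hs'Θ _).trans (pow_le_pow_right₀ hΘ1 (e.symm a').2.isLt.le))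
      (by positivity) (by positivity)
  have habs : |(r : ℝ) - ρ| ≤ Real.exp (-Real.exp (((q : ℝ) ^ 2) ^ (A + 1))) := by
    rw [abs_sub_comm, ← pow_mul]; exact hrlt.le
  -- steps (2)–(5): the clash engine
  exact twoRadical_clash hq hA₀ hN0 hdet hadj hE1 hNlen hNdeg hadjB hΘ1 hθΘ hw hfact hKl (abs_nonneg _) hΦ hA
    habs hLP1 hpB hEdef hcE hcN hcU hc₃ ha hQ₁ hqqN

end Kernel

end Summit.Schanuel.Schanuel.Theorems.RootDecomp1BTwoRadical

end
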